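import Summits.KontsevichZagierPeriods.KontsevichZagierPeriods.Theorems.EllipticMomentKernel.Negative.GeneralCurve
import Summits.KontsevichZagierPeriods.KontsevichZagierPeriods.Theorems.EllipticMomentKernel.Negative.Targets
import Literature.NumberTheory.Transcendental.KZLogCalculusProofs

/-!
# `EllipticMomentKernel` (stmt-KontsevichZagierPeriods-10631), line `merge-first-single-hermite`:
# stub `stub_polynomialPart`

THE POLYNOMIAL PART OF THE CARRIER. For a rational Weierstrass cubic `f = cubic q₂ q₃ = 4x³ − q₂x − q₃`
with `disc > 0` (three real roots `e₃ < e₂ < e₁`, bounded oval `σ = oval q₂ q₃ = (e₃, e₂)`) and any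
`A ∈ ℚ[X]`:

* VALUE: `∫_σ A(x) dx = G(e₂) − G(e₃)` for a rational primitive `G ∈ ℚ[X]` (`G′ = A`,
  `polynomialPart_exists_derivative_eq`; fundamental theorem of calculus on `(e₃, e₂)` transferred
  to `ℝ¹`, `polynomialPart_integral_eq`), a real ALGEBRAIC number since `e₂, e₃` are roots of the
  non-zero `4X³ − q₂X − q₃ ∈ ℚ[X]` (`isAlgebraic_aeval_sub_aeval`, Negative/Targets.lean);
* RELATION when `∫_σ A = 0`: ONE Newton–Leibniz move (KZ rule (3), `KZ.newtonLeibnizRel`) over the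
  point `ℝ⁰` on the CLOSED band `closedBandQ e₃ e₂ = [e₃, e₂] ⊆ ℝ¹` (real algebraic, hence
  `ℚ`-semialgebraic, constant bounds) with the polynomial primitive `F z = G(z 0)` onto the base
  `[pt, G(e₂) − G(e₃)] = [pt, 0]`, the ZERO representation, itself a relation
  (`KZ.of_mem_relations_of_eqOn_zero`); closed band versus open oval is ONE domain-additivity move
  (`KZ.domainAddRel`) across the null two-point set `endsQ e₃ e₂ = {e₃, e₂}`, whose representation
  is a relation (`KZ.of_mem_relations_of_volume_eq_zero`); the GIVEN `s` on `σ` enters the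
  domain-additivity move directly (its integrand agrees with `A(p 0)` on `σ`).

This is the polynomial sibling of the landed `hermiteExactForm_of_mem_relations` (primitive `P√f`)
and of the model `Negative/HermiteMove.lean`; band/ends kit from `Negative/Targets.lean`.
-/

noncomputable section

open MeasureTheory Set
open scoped Polynomial

namespace Summit.KontsevichZagierPeriods.HermiteRigidity.EllipticMomentKernel

open Literature.NumberTheory.Transcendental
open Literature.NumberTheory.Transcendental.KZ
open Summit.KontsevichZagierPeriods.HermiteRigidity.EllipticMomentKernelNegative
open Summit.KontsevichZagierPeriods.KontsevichZagierPeriods.Theses.HermiteRigidity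
  (EllipticMomentKernel HermiteExactFormVanishes)
open Literature.ModelTheory.ExponentialFields (IsSemialgebraic isSemialgebraic_univ)

/-! ## A rational primitive and the value `∫_σ A = G(e₂) − G(e₃)` -/

/-- Every rational polynomial has a rational primitive: `A = G′` with
`G = Σₙ aₙ X^{n+1}/(n+1) ∈ ℚ[X]`. [folklore] -/
theorem polynomialPart_exists_derivative_eq (A : ℚ[X]) :
    ∃ G : ℚ[X], Polynomial.derivative G = A := by
  -- adapted from Negative/PolyConst.lean `exists_derivative_eq`
  induction A using Polynomial.induction_on' with
  | add p q hp hq =>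
    obtain ⟨Gp, hGp⟩ := hp
    obtain ⟨Gq, hGq⟩ := hq
    exact ⟨Gp + Gq, by rw [Polynomial.derivative_add, hGp, hGq]⟩
  | monomial n a =>
    refine ⟨Polynomial.C (a / ((n : ℚ) + 1)) * Polynomial.X ^ (n + 1), ?_⟩
    have hn : ((n : ℚ) + 1) ≠ 0 := by positivity
    rw [Polynomial.derivative_C_mul_X_pow, ← Polynomial.C_mul_X_pow_eq_monomial,
      Nat.add_sub_cancel]
    congr 2
    push_cast
    exact div_mul_cancel₀ a hn

/-- **Value**: `∫_σ A = G(e₂) − G(e₃)` for any primitive `G` of `A` — the fundamental theorem of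
calculus on `(e₃, e₂)`, transferred to `ℝ¹` along `e1 : ℝ¹ ≃ᵐ ℝ`. [folklore] -/
theorem polynomialPart_integral_eq {q₂ q₃ : ℚ} {e₃ e₂ e₁ : ℝ} (h32 : e₃ < e₂) (h21 : e₂ < e₁)
    (hf : ∀ x, cubic q₂ q₃ x = 4 * (x - e₃) * (x - e₂) * (x - e₁)) {A G : ℚ[X]}
    (hG : Polynomial.derivative G = A) :
    ∫ p in oval q₂ q₃, (Polynomial.aeval (p 0) A : ℝ) =
      (Polynomial.aeval e₂ G : ℝ) - Polynomial.aeval e₃ G := by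
  -- adapted from Negative/PolyConst.lean `integral_oval_aeval_eq`
  have hset : oval q₂ q₃ = e1 ⁻¹' Ioo e₃ e₂ := by
    rw [oval_eq_of_roots h32 h21 hf]; ext p; simp [e1_apply]
  rw [hset]
  have h1 := measurePreserving_e1.setIntegral_preimage_emb e1.measurableEmbedding
    (fun x : ℝ => (Polynomial.aeval x A : ℝ)) (Ioo e₃ e₂)
  simp only [e1_apply] at h1
  rw [h1, ← integral_Ioc_eq_integral_Ioo, ← intervalIntegral.integral_of_le h32.le]
  have hderiv : ∀ x ∈ uIcc e₃ e₂,
      HasDerivAt (fun x : ℝ => (Polynomial.aeval x G : ℝ)) (Polynomial.aeval x A) x := by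
    intro x _
    have := Polynomial.hasDerivAt_aeval (R := ℚ) G x
    rwa [hG] at this
  exact intervalIntegral.integral_eq_sub_of_hasDerivAt hderiv
    ((Polynomial.continuous_aeval A).intervalIntegrable _ _)

/-- A polynomial function `p ↦ Q(p 0)` (`Q ∈ ℚ[X]`) is `ℚ`-semialgebraic on every `ℚ`-semialgebraic
subset of `ℝ¹`: it is the evaluation of the `MvPolynomial` `Q(X 0)`.
[cite: BochnakCosteRoy1998, Prop. 2.2.6] -/
theorem polynomialPart_isSemialgebraicFunOn_aeval {t : Set (Fin 1 → ℝ)} (ht : IsSemialgebraic ℚ t)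
    (Q : ℚ[X]) : IsSemialgebraicFunOn ℚ t (fun p => (Polynomial.aeval (p 0) Q : ℝ)) := by
  refine (isSemialgebraicFunOn_aeval ht
    (Polynomial.aeval (MvPolynomial.X 0 : MvPolynomial (Fin 1) ℚ) Q)).congr fun p _ => ?_
  simp only
  rw [← Polynomial.aeval_algHom_apply, MvPolynomial.aeval_X]

/-! ## The move: `[σ, A] ∈ relations` when `∫_σ A = 0` -/

/-- **The polynomial part as a KZ move**: if `∫_σ A = 0`, every representation `s = [σ, A]` lies
in `KZ.relations` — one Newton–Leibniz move over `ℝ⁰` on the closed band `[e₃, e₂]` (algebraic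
ends) with the polynomial primitive `G` (`G′ = A`) onto `[pt, G(e₂) − G(e₃)] = [pt, 0]`, one
domain-additivity move closed band `= σ ∪ {e₃, e₂}` (null ends) with the given `s`.
[cite: KontsevichZagier2001, §1.2 rule (3)] -/
theorem polynomialPart_of_mem_relations {q₂ q₃ : ℚ} (hΔ : 0 < disc q₂ q₃) (A : ℚ[X])
    (h0 : (∫ p in oval q₂ q₃, (Polynomial.aeval (p 0) A : ℝ)) = 0)
    (s : IntegralRep 1) (hs : s.domain = oval q₂ q₃)
    (hsi : EqOn s.integrand (fun p => (Polynomial.aeval (p 0) A : ℝ)) (oval q₂ q₃)) :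
    KZ.of s ∈ KZ.relations := by
  obtain ⟨e₃, e₂, e₁, h3, h2a, h2b, h1, hf⟩ := exists_roots hΔ
  have h32 : e₃ < e₂ := by linarith
  have h21 : e₂ < e₁ := by linarith
  obtain ⟨he₃, he₂, -⟩ := cubic_roots_eq_zero hf
  obtain ⟨G, hG⟩ := polynomialPart_exists_derivative_eq A
  -- the constant of the move vanishes: `G(e₂) − G(e₃) = ∫_σ A = 0`
  have hval : (Polynomial.aeval e₂ G : ℝ) - Polynomial.aeval e₃ G = 0 := by
    rw [← polynomialPart_integral_eq h32 h21 hf hG]; exact h0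
  set g : (Fin 1 → ℝ) → ℝ := fun p => (Polynomial.aeval (p 0) A : ℝ) with hg
  have hband_sa : IsSemialgebraic ℚ (closedBandQ e₃ e₂) := isSemialgebraic_closedBandQ h32 h21 hf
  have hends_sa : IsSemialgebraic ℚ (endsQ e₃ e₂) := isSemialgebraic_endsQ he₃ he₂
  -- integrability of the polynomial integrand: continuous on the compact band, null ends
  have hgi_band : IntegrableOn g (closedBandQ e₃ e₂) := by
    have hsub : closedBandQ e₃ e₂ ⊆ Icc (fun _ => e₃) (fun _ => e₂) := by
      rw [closedBandQ_eq]
      intro p hp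
      rw [mem_Icc, Pi.le_def, Pi.le_def]
      exact ⟨fun i => by fin_cases i; exact hp.1, fun i => by fin_cases i; exact hp.2⟩
    exact (((Polynomial.continuous_aeval A).comp
      (continuous_apply 0)).continuousOn.integrableOn_compact isCompact_Icc).mono_set hsub
  have hgi_ends : IntegrableOn g (endsQ e₃ e₂) := by
    rw [IntegrableOn, Measure.restrict_eq_zero.2 (volume_endsQ e₃ e₂)]
    exact integrable_zero_measure
  -- the band representation `R = [[e₃,e₂], A]`, the ends `N = [{e₃,e₂}, A]`, the base `Z = [pt, 0]`
  obtain ⟨R, hRd, hRi⟩ : ∃ R : IntegralRep 1, R.domain = closedBandQ e₃ e₂ ∧ R.integrand = g :=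
    ⟨{ domain := closedBandQ e₃ e₂
       integrand := g
       isSemialgebraic_domain := hband_sa
       isSemialgebraicFunOn_integrand := polynomialPart_isSemialgebraicFunOn_aeval hband_sa A
       integrableOn := hgi_band }, rfl, rfl⟩
  obtain ⟨N, hNd, hNi⟩ : ∃ N : IntegralRep 1, N.domain = endsQ e₃ e₂ ∧ N.integrand = g :=
    ⟨{ domain := endsQ e₃ e₂
       integrand := g
       isSemialgebraic_domain := hends_sa
       isSemialgebraicFunOn_integrand := polynomialPart_isSemialgebraicFunOn_aeval hends_sa A
       integrableOn := hgi_ends }, rfl, rfl⟩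
  obtain ⟨Z, hZd, hZi⟩ : ∃ Z : IntegralRep 0, Z.domain = univ ∧ Z.integrand = 0 :=
    exists_zeroRep isSemialgebraic_univ
  have hs0 : ∀ (x : Fin 0 → ℝ) (t : ℝ), (Fin.snoc x t : Fin 1 → ℝ) 0 = t := fun _ _ => rfl
  -- (i) ONE Newton–Leibniz move over `ℝ⁰`: `[R] − [Z] ∈ newtonLeibnizRel`, primitive `F z = G(z 0)`
  have hNL : KZ.of R - KZ.of Z ∈ newtonLeibnizRel := by
    refine ⟨0, R, Z, fun _ => e₃, fun _ => e₂, fun z => (Polynomial.aeval (z 0) G : ℝ),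
      ?_, ?_, ?_, fun _ _ => h32.le, ?_, ?_, ?_, ?_, rfl⟩
    · rw [hRd]; exact polynomialPart_isSemialgebraicFunOn_aeval hband_sa G
    · rw [hZd]; exact isSemialgebraicFunOn_const_root he₃
    · rw [hZd]; exact isSemialgebraicFunOn_const_root he₂
    · rw [hRd, hZd]; rfl
    · -- continuity of `t ↦ G(t)` on the closed fibre
      intro x _
      simp only [hs0]
      exact (Polynomial.continuous_aeval G).continuousOn
    · -- derivative `G′ = A` on the open fibre
      intro x _ t _
      rw [hRi]
      simp only [hs0, hg]
      have := Polynomial.hasDerivAt_aeval (R := ℚ) G t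
      rwa [hG] at this
    · -- `Z.integrand = 0 = G(e₂) − G(e₃)`
      intro x _
      rw [hZi]
      simp only [hs0, Pi.zero_apply]
      exact hval.symm
  -- (ii) the base `[pt, 0]` and the null ends are relations, hence so is `[R]`
  have hZ : KZ.of Z ∈ relations :=
    of_mem_relations_of_eqOn_zero Z (by rw [hZi]; exact fun _ _ => rfl)
  have hN : KZ.of N ∈ relations :=
    of_mem_relations_of_volume_eq_zero N (by rw [hNd]; exact volume_endsQ e₃ e₂)
  have hR : KZ.of R ∈ relations := by
    have h := relations.add_mem (newtonLeibnizRel_subset_relations hNL) hZ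
    rwa [sub_add_cancel] at h
  -- (iii) closed band versus open oval: ONE domain-additivity move `[R] − [s] − [N]`
  have hDA : KZ.of R - KZ.of s - KZ.of N ∈ domainAddRel := by
    refine ⟨1, R, s, N, by rw [hRd, hs, hNd, closedBandQ_eq_union h32 h21 hf], ?_, ?_, ?_, rfl⟩
    · rw [hs, hNd, oval_inter_endsQ h32 h21 hf, measure_empty]
    · rw [hs, hRi]
      intro p hp
      exact (hsi hp).symm
    · rw [hRi, hNi]; exact fun _ _ => rfl
  have : KZ.of s = KZ.of R - (KZ.of R - KZ.of s - KZ.of N) - KZ.of N := by abel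
  rw [this]
  exact relations.sub_mem (relations.sub_mem hR (domainAddRel_subset_relations hDA)) hN

/-! ## The stub -/

/-- **Stub `stub_polynomialPart`**: the polynomial part of the carrier. `∫_σ A = G(e₂) − G(e₃)`
(`G′ = A`, `G ∈ ℚ[X]`) is a real ALGEBRAIC number (`e₂, e₃` are roots of `4x³ − q₂x − q₃`,
`isAlgebraic_of_cubic_eq_zero`), and when it vanishes `[σ, A] ∈ relations`: one Newton–Leibniz move
over `ℝ⁰` on the closed band `[e₃,e₂]` with primitive `G` onto `[pt, G(e₂) − G(e₃)] = [pt, 0]`,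
plus closed band versus open `σ`. [cite: KontsevichZagier2001, §1.2 rule (3)] -/
theorem stub_polynomialPart (q₂ q₃ : ℚ) (hΔ : 0 < disc q₂ q₃) (A : ℚ[X]) :
    IsAlgebraic ℚ (∫ p in oval q₂ q₃, (Polynomial.aeval (p 0) A : ℝ)) ∧
    ((∫ p in oval q₂ q₃, (Polynomial.aeval (p 0) A : ℝ)) = 0 →
      ∀ s : IntegralRep 1, s.domain = oval q₂ q₃ →
        EqOn s.integrand (fun p => (Polynomial.aeval (p 0) A : ℝ)) (oval q₂ q₃) →
        KZ.of s ∈ KZ.relations) := by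
  refine ⟨?_, fun h0 s hs hsi => polynomialPart_of_mem_relations hΔ A h0 s hs hsi⟩
  obtain ⟨e₃, e₂, e₁, h3, h2a, h2b, h1, hf⟩ := exists_roots hΔ
  have h32 : e₃ < e₂ := by linarith
  have h21 : e₂ < e₁ := by linarith
  obtain ⟨he₃, he₂, -⟩ := cubic_roots_eq_zero hf
  obtain ⟨G, hG⟩ := polynomialPart_exists_derivative_eq A
  rw [polynomialPart_integral_eq h32 h21 hf hG]
  exact isAlgebraic_aeval_sub_aeval he₃ he₂ G

end Summit.KontsevichZagierPeriods.HermiteRigidity.EllipticMomentKernel
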